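import Summits.Ventures.PercRepro.ProfilePointedCircuitClassesFlatRelative

/-!
# PercRepro — THE LOCAL LYM CERTIFICATE: A RELATION WHOSE UNITS ARE NEVER BUSIER THAN ITS DEMANDS, AND THE
BALANCED-INTERSECTION RELATIONS OF THE IN–OUT FAMILY (p5, gen 47; `proofs/P5-GM1.md` §69)

THE LEMMA (`card_le_card_of_localLym`, pure counting): for finite families `A`, `B` and a relation `r`, if every
`a ∈ A` has at least one neighbour and on every edge `(a, b)` the number of neighbours of `b` is at most the number
of neighbours of `a` (`p(b) ≤ s(a)`, the LOCAL LYM condition), then `#A ≤ #B` — the weighting `1/s(a)` on the edges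
gives each `a` total weight `1` and each `b` total weight `≤ p(b)/p(b) = 1`.

THE RELATIONS. For the in–out inequality `in_ν(e) ≤ out_{ν+1}(e)` (demands `X ∈ BI_ν ∋ e`, units `T ∈ BI_{ν+1} ∌ e`)
the relation `R_k := {(X, T) : #(X ∩ T) = k}`; for the one-point per-set inequality (PS)_c of §68 ADDENDUM 2
(demands `X ∈ BI_4 ∋ c, e`, units `T ∈ BI_5 ∋ c ∌ e`) the relation `R₂ = {#(X ∩ T) = 2}` (`T` shares with `X` exactly
one point besides `c`).  `LocalLymInOut N ν k e` / `LocalLymPairTwo α` / `LocalLymTwelveTwo α` are the local LYM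
conditions for these relations, as `Prop`s, NOT asserted.  CENSUS (§69, own exact code, GF(2,3,5,7) matroids with
injected parallel / collinear / coplanar points): the BALANCED relation (`X − e` meets `T` and `E ∖ T` in equally many
points) passes on every instance tested — `n = 12`, `ρ = 7`, `k = 2`: 0 violations on 5,331,480 edges of 348 points,
min slack 7 (`k = 1, 3` fail); `n = 10`, `ρ = 6`, `k = 2`: 0 / 280 points, slack ≥ 3 (`k = 0`, §59's disjointness,
fails); (PS)_c at `n = 10`, `R₂`: 0 / 22,574 points, slack ≥ 2 (the c-disjoint and replacement relations fail).
The reductions: `inCount_le_outCount_succ_of_localLymInOut`, `thruCount_four_pair_le_of_localLymPairTwo`,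
`inOutBottomTwelve_of_localLymTwelveTwo` — the twelve-point statement follows from the local LYM condition of the
balanced relation at `n = 12`.
-/

open scoped Matroid

namespace PercRepro.Cogirth

open Finset ThmH Skew Shadow Profile

/-! ### The counting lemma -/

section LocalLym

variable {β γ : Type}

/-- **THE LOCAL LYM LEMMA**: if every `a ∈ A` has a neighbour in `B` and on every edge `(a, b)` the degree of `b`
(into `A`) is at most the degree of `a` (into `B`), then `#A ≤ #B`.  Proof: put the weight `1 / deg a` on every edge;
each `a` carries total weight `1`, each `b` at most `deg b · (1 / deg b) ≤ 1`. -/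
theorem card_le_card_of_localLym (A : Finset β) (B : Finset γ) (r : β → γ → Prop) [DecidableRel r]
    (hdeg : ∀ a ∈ A, 0 < (B.filter (fun b => r a b)).card)
    (hlym : ∀ a ∈ A, ∀ b ∈ B, r a b →
      (A.filter (fun a' => r a' b)).card ≤ (B.filter (fun b' => r a b')).card) :
    A.card ≤ B.card := by
  -- the edge weights
  let w : β → γ → ℚ := fun a b => if r a b then (1 : ℚ) / ((B.filter (fun b' => r a b')).card : ℚ) else 0
  have hA : (A.card : ℚ) = ∑ a ∈ A, ∑ b ∈ B, w a b := by
    rw [card_eq_sum_ones, Nat.cast_sum]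
    apply sum_congr rfl
    intro a ha
    have hs := hdeg a ha
    simp only [w]
    rw [← sum_filter, sum_const, nsmul_eq_mul, Nat.cast_one, mul_one_div, div_self]
    exact_mod_cast hs.ne'
  have hB : ∀ b ∈ B, ∑ a ∈ A, w a b ≤ 1 := by
    intro b hb
    simp only [w]
    rw [← sum_filter]
    by_cases hp : (A.filter (fun a => r a b)).card = 0
    · rw [card_eq_zero] at hp
      rw [hp, sum_empty]
      exact zero_le_one
    · calc ∑ a ∈ A.filter (fun a => r a b), (1 : ℚ) / ((B.filter (fun b' => r a b')).card : ℚ)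
          ≤ ∑ a ∈ A.filter (fun a => r a b), (1 : ℚ) / ((A.filter (fun a' => r a' b)).card : ℚ) := by
            apply sum_le_sum
            intro a ha
            rw [mem_filter] at ha
            apply one_div_le_one_div_of_le
            · exact_mod_cast Nat.pos_of_ne_zero hp
            · exact_mod_cast hlym a ha.1 b hb ha.2
        _ = ((A.filter (fun a' => r a' b)).card : ℚ) * (1 / ((A.filter (fun a' => r a' b)).card : ℚ)) := by
            rw [sum_const, nsmul_eq_mul]
        _ = 1 := by
            rw [mul_one_div, div_self]
            exact_mod_cast hp
  have hsum : (A.card : ℚ) ≤ B.card := by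
    rw [hA, sum_comm]
    calc ∑ b ∈ B, ∑ a ∈ A, w a b ≤ ∑ b ∈ B, (1 : ℚ) := sum_le_sum hB
      _ = B.card := by rw [sum_const, nsmul_eq_mul, mul_one]
  exact_mod_cast hsum

end LocalLym

/-! ### The in–out family: the relation `#(X ∩ T) = k` -/

section InOutLym

variable {α : Type} [DecidableEq α] {N : Matroid α} [N.Finite]

/-- **THE LOCAL LYM CONDITION OF THE RELATION `R_k` FOR `in_ν(e) ≤ out_{ν+1}(e)`** (a `Prop`, NOT asserted):
every demand `X ∈ BI_ν ∋ e` has a unit `T ∈ BI_{ν+1} ∌ e` with `#(X ∩ T) = k`, and on every such edge the units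
`T' ∌ e` with `#(X ∩ T') = k` are at least the demands `X' ∋ e` with `#(X' ∩ T) = k`. -/
def LocalLymInOut (N : Matroid α) [N.Finite] (ν k : ℕ) (e : α) : Prop :=
  ∀ X ∈ (biIndepSets N ν).filter (fun X => e ∈ X),
    0 < (((biIndepSets N (ν + 1)).filter (fun T => e ∉ T)).filter (fun T => (X ∩ T).card = k)).card ∧
    ∀ T ∈ (biIndepSets N (ν + 1)).filter (fun T => e ∉ T), (X ∩ T).card = k →
      (((biIndepSets N ν).filter (fun X => e ∈ X)).filter (fun X' => (X' ∩ T).card = k)).card ≤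
        (((biIndepSets N (ν + 1)).filter (fun T => e ∉ T)).filter (fun T' => (X ∩ T').card = k)).card

/-- **THE LOCAL LYM CONDITION IMPLIES THE IN–OUT INEQUALITY**: `LocalLymInOut N ν k e → in_ν(e) ≤ out_{ν+1}(e)`. -/
theorem inCount_le_outCount_succ_of_localLymInOut {ν k : ℕ} {e : α} (h : LocalLymInOut N ν k e) :
    inCount N ν e ≤ outCount N (ν + 1) e := by
  unfold inCount outCount
  exact card_le_card_of_localLym _ _ (fun X T => (X ∩ T).card = k)
    (fun X hX => (h X hX).1) (fun X hX T hT hXT => (h X hX).2 T hT hXT)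

/-- The balanced relation at `n = 12` for every point (a `Prop`, NOT asserted; §69: 0 violations on 5,331,480 edges). -/
def LocalLymTwelveTwo (α : Type) [DecidableEq α] : Prop :=
  ∀ (N : Matroid α) [N.Finite] (e : α), e ∈ gr N → (gr N).card = 12 → rk N (gr N) = 7 → LocalLymInOut N 5 2 e

/-- **THE TWELVE-POINT STATEMENT FOLLOWS FROM THE LOCAL LYM CONDITION OF THE BALANCED RELATION**:
`LocalLymTwelveTwo α → InOutBottomTwelve α`. -/
theorem inOutBottomTwelve_of_localLymTwelveTwo (h : LocalLymTwelveTwo α) : InOutBottomTwelve α := by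
  intro N _ e he hn hR
  exact inCount_le_outCount_succ_of_localLymInOut (h N e he hn hR)

/-- The relation `#(X ∩ T) = 2` at `n = 10` for every point (a `Prop`, NOT asserted; §69: 0 violations, slack ≥ 3) —
an alternative certificate for the `n = 10` theorem `inCount_four_le_outCount_five_of_card_ten` (§59). -/
def LocalLymTenTwo (α : Type) [DecidableEq α] : Prop :=
  ∀ (N : Matroid α) [N.Finite] (e : α), e ∈ gr N → (gr N).card = 10 → rk N (gr N) = 6 → LocalLymInOut N 4 2 e

/-- The `n = 10` theorem from the local LYM condition of `R₂` (the route not taken in §59). -/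
theorem inCount_four_le_outCount_five_of_localLymTenTwo (h : LocalLymTenTwo α) (e : α) (he : e ∈ gr N)
    (hn : (gr N).card = 10) (hR : rk N (gr N) = 6) : inCount N 4 e ≤ outCount N 5 e :=
  inCount_le_outCount_succ_of_localLymInOut (h N e he hn hR)

end InOutLym

/-! ### The one-point per-set inequality (PS)_c: the relation `#(X ∩ T) = 2` -/

section PairLym

variable {α : Type} [DecidableEq α] {N : Matroid α} [N.Finite]

/-- The demands of (PS)_c at `(c, e)`: the bi-independent `4`-sets through `c` and `e`. -/
noncomputable def pairDemands (N : Matroid α) [N.Finite] (c e : α) : Finset (Finset α) :=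
  (biIndepSets N 4).filter (fun X => c ∈ X ∧ e ∈ X)

/-- The units of (PS)_c at `(c, e)`: the bi-independent `5`-sets through `c` avoiding `e`. -/
noncomputable def pairUnits (N : Matroid α) [N.Finite] (c e : α) : Finset (Finset α) :=
  (biIndepSets N 5).filter (fun T => c ∈ T ∧ e ∉ T)

/-- `thru_4({c, e}) = #pairDemands`. -/
theorem thruCount_four_pair_eq_card_pairDemands (c e : α) :
    thruCount N 4 ({c, e} : Finset α) = (pairDemands N c e).card := by
  unfold thruCount pairDemands
  apply congrArg
  apply filter_congr
  intro X _
  constructor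
  · intro h
    exact ⟨h (mem_insert_self c {e}), h (mem_insert_of_mem (mem_singleton_self e))⟩
  · rintro ⟨hc, he⟩ x hx
    rw [mem_insert, mem_singleton] at hx
    rcases hx with rfl | rfl
    · exact hc
    · exact he

/-- **THE LOCAL LYM CONDITION OF `R₂` FOR (PS)_c** (a `Prop`, NOT asserted; §69: 0 violations on 22,574 points,
slack ≥ 2): on every coloop-free matroid with `10` points and rank `6` and every `c ≠ e`, every demand `X ∋ c, e` has a
unit `T ∋ c ∌ e` with `#(X ∩ T) = 2`, and on every such edge the units `T'` with `#(X ∩ T') = 2` are at least the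
demands `X'` with `#(X' ∩ T) = 2`. -/
def LocalLymPairTwo (α : Type) [DecidableEq α] : Prop :=
  ∀ (N : Matroid α) [N.Finite] (c e : α), (gr N).card = 10 → rk N (gr N) = 6 →
    (∀ x ∈ gr N, rk N ((gr N).erase x) = 6) → c ≠ e →
    ∀ X ∈ pairDemands N c e,
      0 < ((pairUnits N c e).filter (fun T => (X ∩ T).card = 2)).card ∧
      ∀ T ∈ pairUnits N c e, (X ∩ T).card = 2 →
        ((pairDemands N c e).filter (fun X' => (X' ∩ T).card = 2)).card ≤
          ((pairUnits N c e).filter (fun T' => (X ∩ T').card = 2)).card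

/-- **(PS)_c FROM THE LOCAL LYM CONDITION OF `R₂`**: `thru_4({c, e}) ≤ #{T ∈ BI_5 : c ∈ T, e ∉ T}` on every
coloop-free matroid with `10` points and rank `6`, for every `c ≠ e` — the sharp form of
`thruCount_four_pair_le_two_mul`, modulo `LocalLymPairTwo`. -/
theorem thruCount_four_pair_le_of_localLymPairTwo (h : LocalLymPairTwo α) (hn : (gr N).card = 10)
    (hR : rk N (gr N) = 6) (hcf : ∀ x ∈ gr N, rk N ((gr N).erase x) = 6) {c e : α} (hce : c ≠ e) :
    thruCount N 4 ({c, e} : Finset α) ≤ ((biIndepSets N 5).filter (fun T => c ∈ T ∧ e ∉ T)).card := by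
  rw [thruCount_four_pair_eq_card_pairDemands]
  exact card_le_card_of_localLym _ _ (fun X T => (X ∩ T).card = 2)
    (fun X hX => (h N c e hn hR hcf hce X hX).1) (fun X hX T hT hXT => (h N c e hn hR hcf hce X hX).2 T hT hXT)

end PairLym

end PercRepro.Cogirth
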